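import Summits.BirchSwinnertonDyer.BirchSwinnertonDyer.Theorems.AlignedTransportAtTwoMainConjectureOfRankZeroBSDAtTwoCubicSplitStratumLayerTwoRelationDoor
import Summits.BirchSwinnertonDyer.BirchSwinnertonDyer.Theorems.AlignedTransportAtTwoMainConjectureOfRankZeroBSDAtTwoCubicCarrierRoad
import Summits.BirchSwinnertonDyer.BirchSwinnertonDyer.Theorems.AlignedTransportAtTwoMainConjectureOfRankZeroBSDAtTwoCubicSplitStratumSeedN25861
import Literature.NumberTheory.NumberFields.CubicFieldIntegers
import Literature.NumberTheory.NumberFields.CubicFieldResiduePrimes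
import HarnessLib

/-!
# Route `AlignedTransportAtTwo`, crux C2 `MainConjectureOfRankZeroBSDAtTwo` (stmt-BirchSwinnertonDyer-22298):
# ROW for the split-stratum seed `⟨1, −1, 0, −31, −64⟩` (conductor `25861`, tag `n25861`; Dedekind-type cubic field `−2351`) BY THE RELATION ROAD AT LAYER TWO:
# ★★★ **`rank₂ Cl(K_m) ≤ 2 ∀ m`, `μ₂ = 0`, `λ₂ ≤ 2` — UNCONDITIONALLY — for every cyclotomic `ℤ₂`-extension of the cubic `2`-torsion field `ℚ(β)` of
# `⟨1, −1, 0, −31, −64⟩`**, from ONE relation `c·(σc)²·σ²c = 1` in `Cl(K_2)`, `K_2 = ℚ(β)·ℚ(ζ₁₆)⁺`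

HONEST FRAMING (cell `bsd-f1-sign2`, WIDTH-5 attached prover seat `bsd-line-att-p4` gen 46 on line `birth` of the lead `bsd-line-att-p2`;
`--supports` stmt-BirchSwinnertonDyer-22298, closes nothing; BSD is NOT proved by any of this; the crux C2, its verdict «blocked-on
`Rank1Residual.GreenbergMuConjectureIrreducible`» and every registered stub are untouched).  THEOREMS ONLY (no `def`, no named fact, no instance, no `sorry`).

WHAT.  `W = ⟨1, −1, 0, −31, −64⟩` (conductor `25861`, `Δ_min ≡ 1 (mod 8)`: ON the Kilford stratum; cubic `2`-torsion field `K = ℚ(β) = ℚ(θ)`, `θ³ − 4θ² + 11θ + 8 = 0`,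
`𝓞_K = ℤ ⊕ ℤθ ⊕ ℤδ`, `δ = (θ² + θ)/2`, `h_K = 1` — this seat's `CubicDisc2351` and `…CubicSplitStratumSeedN25861`; the field is shared by the two census seeds of
conductor `25861`) is a seed of att-p3 g53's split-stratum census (`r = rank₂ Cl(K(√2)) = 1`; unit `ε = −819 − 1548θ + 710δ` with dyadic bits `(0, 1, 1)`:
`ε ≡ −1 (mod 𝔭₁³)` at `𝔭₁ = (1 + 2θ − δ)`, `ε ≡ −3 (mod 𝔭'³)` at `𝔭' = (−3 − 7θ + 9δ)`).  WHAT FIRES: the SPLIT-STRATUM LAYER-TWO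
RELATION ROAD (this seat's coordinate door `…CubicSplitStratumLayerTwoRelationDoor`): with `q₀ = 7 + 14θ − 10δ` (norm `97`, `(q₀)` maximal, `q₀ ≡ 3 (mod 𝔭₁³)`),
`t = 4`, `𝔠 = (q₀², s₂ − 4)` and `σ : s₂ ↦ s₂³ − 3s₂`: **`𝔠·(σ𝔠)²·σ²𝔠 = (y)`** with `y = [[23, 38, -2], [-5, -9, -4], [-15, -24, -4], [16, 28, 0]]` on `(1, s₁, s₂, s₁s₂) × (1, θ, δ)` (LLL in the
degree-`12` field, pure python, seconds; `N_{K_2/K}(y) = −q₀⁴`), relation polynomial `(1 + X)² = (X − 1)² + 2·2X`, `d = 2 ≤ 2² − 2`; every identity decided by the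
kernel in `ℤ ⊕ ℤθ ⊕ ℤδ` (one `linear_combination` against the multiplication table of `CubicDisc2351` each), residues by `decide`.  THEN (★★★
`classGroupPRank_le_two_and_mu_lambda_cubicField_n25861`, UNCONDITIONAL) for `β` ANY root of the `2`-division cubic and EVERY cyclotomic `ℤ₂`-extension `κ` of `ℚ(β)`:
`rank₂ Cl(K_m) ≤ 2 ∀ m`, `μ₂(κ) = 0`, `λ₂(κ) ≤ 2`; and (★) `MC₂(W)` modulo PRINT⁵ + MuIneqʳ + the crux's own hypotheses (att-p5 g24's carrier road).
BSD is NOT proved; nothing is closed; C2's verdict is untouched.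

References: [Washington1997] §13.1, §13.3 Lemmas 13.15, 13.18, Prop. 13.22–13.23; [Lang1990] Ch. 13 §4 Lemma 4.1; [Fukuda1994] Thm. 1; [Gras2003] IV.4;
[NeukirchANT1999] Ch. I §3, §8, Ch. III (1.6)–(1.7); [Omeara1963] §63B; [Cohen1993] §4.7, §6.5; [Marcus2018] Ch. 3 Thm. 27 and Ex. 21; [LMFDB] ec 25861,
nf 3.1.2351.1; [Kato2004Asterisque] Thm. 17.4; [GreenbergLNM1716] Thm. 4.1; tree: this seat's `…CubicSplitStratumLayerTwoRelationDoor`, `…RowN17671` (first customer),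
`CubicFieldDiscriminant2351{,ClassNumber}`, `…CubicSplitStratumSeedN25861`; att-p3 g53 `…CubicSplitStratumRelationDoor`; att-p4 g43 `…RowN4307` (template); att-p5 g24
`…CubicCarrierRoad`.
-/

set_option linter.dupNamespace false
set_option autoImplicit false

noncomputable section

open scoped Classical NumberField nonZeroDivisors IntermediateField

namespace Summit.BirchSwinnertonDyer.BirchSwinnertonDyer.Theorems.AlignedTransportAtTwoCubicSplitStratumLayerTwoRelationRowN25861

open NumberField IsDedekindDomain Polynomial WeierstrassCurve IntermediateField CongruenceSubgroup Module
  Literature.NumberTheory.IwasawaTheory Literature.NumberTheory.GaloisRepresentations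
  Literature.NumberTheory.EllipticCurves Literature.NumberTheory.EllipticCurves.Greenberg1999
  Literature.NumberTheory.EllipticCurves.ModularForms Literature.NumberTheory.EllipticCurves.Rank1Residual
  Literature.NumberTheory.EllipticCurves.Module
  Literature.NumberTheory.NumberFields Literature.NumberTheory.CubicFields
  Summit.BirchSwinnertonDyer.Rank1Residual Summit.BirchSwinnertonDyer.Rank1Residual.X1.MuLambda
  Summit.BirchSwinnertonDyer.Rank1Residual.X5 Summit.BirchSwinnertonDyer.Rank1Residual.X5.O1
  Summit.BirchSwinnertonDyer.Rank1Residual.X5.Instances Summit.BirchSwinnertonDyer.Rank1Residual.F1Sign2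
  Summit.BirchSwinnertonDyer.BirchSwinnertonDyer.Theorems.Rank1ResidualX1Defs
  Summit.BirchSwinnertonDyer.BirchSwinnertonDyer.Theorems.AlignedTransportAtTwoCubicCarrierRoad
  Summit.BirchSwinnertonDyer.BirchSwinnertonDyer.Theorems.AlignedTransportAtTwoCubicSplitStratumSeedN25861
  Summit.BirchSwinnertonDyer.BirchSwinnertonDyer.Theorems.AlignedTransportAtTwoCubicSplitStratumLayerTwoRelationDoor

/-! ## §1 Residue maps of `𝓞_{ℚ(β)} = ℤ ⊕ ℤθ ⊕ ℤδ` (through `θ`, every odd `p`), the dyadic primes `𝔭₁ = (1 + 2 * θ - δ)`, `𝔭' = (-3 - 7 * θ + 9 * δ)`, maximality of `(q₀)` -/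

/-- `ψ_97 : 𝓞_{ℚ(β)} → ℤ/97` with `ψ(θ) = 27` (hence `ψ(δ) = 87`) — the degree-one prime `(97, θ − 27) = (q₀)`. [cite: Marcus2018, Ch. 3, Thm. 27] -/
theorem exists_residueHom_q {β : AlgebraicClosure ℚ} (hβ : aeval β ((⟨1, -1, 0, -31, -64⟩ : WeierstrassCurve ℤ).baseChange ℚ).twoTorsionPolynomial.toPoly = 0) :
    ∃ ψ : 𝓞 ↥(IntermediateField.adjoin ℚ ({β} : Set (AlgebraicClosure ℚ))) →+* ZMod 97, ψ (MonicCubic.thetaInt (aeval_theta_n25861 hβ)) = ((27 : ℤ) : ZMod 97) :=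
  haveI : FiniteDimensional ℚ ↥(IntermediateField.adjoin ℚ ({β} : Set (AlgebraicClosure ℚ))) := IntermediateField.adjoin.finiteDimensional ((AlgebraicClosure.isAlgebraic ℚ).isAlgebraic β).isIntegral
  haveI : NumberField ↥(IntermediateField.adjoin ℚ ({β} : Set (AlgebraicClosure ℚ))) := NumberField.mk
  haveI : Fact (Nat.Prime 97) := ⟨by norm_num⟩
  MonicCubic.exists_residueHom CubicDisc2351.irreducible_polyQ (aeval_theta_n25861 hβ) (finrank_cubicField_n25861 hβ)
    (CubicDisc2351.mem2 (finrank_cubicField_n25861 hβ) (aeval_theta_n25861 hβ)) (by norm_num) ((27) : ℤ) (by decide)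

/-- `χ_13 : 𝓞_{ℚ(β)} → ℤ/13` with `χ(θ) = 4` (hence `χ(δ) = 10`); `±ε` are non-squares there (`χ(ε) = 11`, `13 ≡ 1 (mod 4)`). [cite: Marcus2018, Ch. 3, Thm. 27] -/
theorem exists_residueHom_chi {β : AlgebraicClosure ℚ} (hβ : aeval β ((⟨1, -1, 0, -31, -64⟩ : WeierstrassCurve ℤ).baseChange ℚ).twoTorsionPolynomial.toPoly = 0) :
    ∃ ψ : 𝓞 ↥(IntermediateField.adjoin ℚ ({β} : Set (AlgebraicClosure ℚ))) →+* ZMod 13, ψ (MonicCubic.thetaInt (aeval_theta_n25861 hβ)) = ((4 : ℤ) : ZMod 13) :=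
  haveI : FiniteDimensional ℚ ↥(IntermediateField.adjoin ℚ ({β} : Set (AlgebraicClosure ℚ))) := IntermediateField.adjoin.finiteDimensional ((AlgebraicClosure.isAlgebraic ℚ).isAlgebraic β).isIntegral
  haveI : NumberField ↥(IntermediateField.adjoin ℚ ({β} : Set (AlgebraicClosure ℚ))) := NumberField.mk
  haveI : Fact (Nat.Prime 13) := ⟨by norm_num⟩
  MonicCubic.exists_residueHom CubicDisc2351.irreducible_polyQ (aeval_theta_n25861 hβ) (finrank_cubicField_n25861 hβ)
    (CubicDisc2351.mem2 (finrank_cubicField_n25861 hβ) (aeval_theta_n25861 hβ)) (by norm_num) ((4) : ℤ) (by decide)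

/-- **`N(𝔭₁) = 2`** for `𝔭₁ = (1 + 2 * θ - δ)` (the bit-`0` dyadic prime: every unit is `≡ ±1 (mod 𝔭₁³)`). [cite: Marcus2018, Ch. 3, Thm. 27 and Exercise 21] -/
theorem absNorm_span_pi1_n25861 {β : AlgebraicClosure ℚ} (hβ : aeval β ((⟨1, -1, 0, -31, -64⟩ : WeierstrassCurve ℤ).baseChange ℚ).twoTorsionPolynomial.toPoly = 0) :
    haveI : FiniteDimensional ℚ ↥(IntermediateField.adjoin ℚ ({β} : Set (AlgebraicClosure ℚ))) := IntermediateField.adjoin.finiteDimensional ((AlgebraicClosure.isAlgebraic ℚ).isAlgebraic β).isIntegral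
    haveI : NumberField ↥(IntermediateField.adjoin ℚ ({β} : Set (AlgebraicClosure ℚ))) := NumberField.mk
    Ideal.absNorm (Ideal.span {((1 : 𝓞 ↥(IntermediateField.adjoin ℚ ({β} : Set (AlgebraicClosure ℚ)))) + (2 : 𝓞 ↥(IntermediateField.adjoin ℚ ({β} : Set (AlgebraicClosure ℚ)))) * MonicCubic.thetaInt (aeval_theta_n25861 hβ) + (-1 : 𝓞 ↥(IntermediateField.adjoin ℚ ({β} : Set (AlgebraicClosure ℚ)))) * MonicCubic.thetaInt (CubicDisc2351.delta_root (aeval_theta_n25861 hβ)))}) = 2 := by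
  haveI : FiniteDimensional ℚ ↥(IntermediateField.adjoin ℚ ({β} : Set (AlgebraicClosure ℚ))) := IntermediateField.adjoin.finiteDimensional ((AlgebraicClosure.isAlgebraic ℚ).isAlgebraic β).isIntegral
  haveI : NumberField ↥(IntermediateField.adjoin ℚ ({β} : Set (AlgebraicClosure ℚ))) := NumberField.mk
  rw [show (((1 : 𝓞 ↥(IntermediateField.adjoin ℚ ({β} : Set (AlgebraicClosure ℚ)))) + (2 : 𝓞 ↥(IntermediateField.adjoin ℚ ({β} : Set (AlgebraicClosure ℚ)))) * MonicCubic.thetaInt (aeval_theta_n25861 hβ) + (-1 : 𝓞 ↥(IntermediateField.adjoin ℚ ({β} : Set (AlgebraicClosure ℚ)))) * MonicCubic.thetaInt (CubicDisc2351.delta_root (aeval_theta_n25861 hβ))) : 𝓞 ↥(IntermediateField.adjoin ℚ ({β} : Set (AlgebraicClosure ℚ)))) = (1 + 2 * MonicCubic.thetaInt (aeval_theta_n25861 hβ) - MonicCubic.thetaInt (CubicDisc2351.delta_root (aeval_theta_n25861 hβ)) : 𝓞 ↥(IntermediateField.adjoin ℚ ({β} : Set (AlgebraicClosure ℚ))))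 by ring, Ideal.absNorm_span_singleton]
  exact CubicDisc2351.natAbs_norm_piA (finrank_cubicField_n25861 hβ) (aeval_theta_n25861 hβ)

/-- **`N(𝔭') = 2`** for `𝔭' = (-3 - 7 * θ + 9 * δ)` (a bit-`1` dyadic prime: the unit `ε` is `≡ ±3 (mod 𝔭'³)`, not a norm from `ℚ(β,√2)`). [cite: Marcus2018, Ch. 3, Thm. 27 and Exercise 21] -/
theorem absNorm_span_pip_n25861 {β : AlgebraicClosure ℚ} (hβ : aeval β ((⟨1, -1, 0, -31, -64⟩ : WeierstrassCurve ℤ).baseChange ℚ).twoTorsionPolynomial.toPoly = 0) :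
    haveI : FiniteDimensional ℚ ↥(IntermediateField.adjoin ℚ ({β} : Set (AlgebraicClosure ℚ))) := IntermediateField.adjoin.finiteDimensional ((AlgebraicClosure.isAlgebraic ℚ).isAlgebraic β).isIntegral
    haveI : NumberField ↥(IntermediateField.adjoin ℚ ({β} : Set (AlgebraicClosure ℚ))) := NumberField.mk
    Ideal.absNorm (Ideal.span {((-3 : 𝓞 ↥(IntermediateField.adjoin ℚ ({β} : Set (AlgebraicClosure ℚ)))) + (-7 : 𝓞 ↥(IntermediateField.adjoin ℚ ({β} : Set (AlgebraicClosure ℚ)))) * MonicCubic.thetaInt (aeval_theta_n25861 hβ) + (9 : 𝓞 ↥(IntermediateField.adjoin ℚ ({β} : Set (AlgebraicClosure ℚ)))) * MonicCubic.thetaInt (CubicDisc2351.delta_root (aeval_theta_n25861 hβ)))}) = 2 := by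
  haveI : FiniteDimensional ℚ ↥(IntermediateField.adjoin ℚ ({β} : Set (AlgebraicClosure ℚ))) := IntermediateField.adjoin.finiteDimensional ((AlgebraicClosure.isAlgebraic ℚ).isAlgebraic β).isIntegral
  haveI : NumberField ↥(IntermediateField.adjoin ℚ ({β} : Set (AlgebraicClosure ℚ))) := NumberField.mk
  rw [show (((-3 : 𝓞 ↥(IntermediateField.adjoin ℚ ({β} : Set (AlgebraicClosure ℚ)))) + (-7 : 𝓞 ↥(IntermediateField.adjoin ℚ ({β} : Set (AlgebraicClosure ℚ)))) * MonicCubic.thetaInt (aeval_theta_n25861 hβ) + (9 : 𝓞 ↥(IntermediateField.adjoin ℚ ({β} : Set (AlgebraicClosure ℚ)))) * MonicCubic.thetaInt (CubicDisc2351.delta_root (aeval_theta_n25861 hβ))) : 𝓞 ↥(IntermediateField.adjoin ℚ ({β} : Set (AlgebraicClosure ℚ)))) = (-3 - 7 * MonicCubic.thetaInt (aeval_theta_n25861 hβ) + 9 * MonicCubic.thetaInt (CubicDisc2351.delta_root (aeval_theta_n25861 hβ)) : 𝓞 ↥(IntermediateField.adjoin ℚ ({β} : Set (AlgebraicClosure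 ℚ)))) by ring, Ideal.absNorm_span_singleton]
  exact CubicDisc2351.natAbs_norm_piB (finrank_cubicField_n25861 hβ) (aeval_theta_n25861 hβ)

/-- **`(q₀) = (97, θ − 27)` is maximal** (kernel of `ψ_97`; `97 = q₀·q₀'`, `θ − 27 = q₀·w`, `q₀ ∈ (97, θ − 27)` with explicit witnesses on `1, θ, δ`).
[cite: Marcus2018, Ch. 3, Thm. 27] -/
theorem isMaximal_span_q0_n25861 {β : AlgebraicClosure ℚ} (hβ : aeval β ((⟨1, -1, 0, -31, -64⟩ : WeierstrassCurve ℤ).baseChange ℚ).twoTorsionPolynomial.toPoly = 0) :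
    haveI : FiniteDimensional ℚ ↥(IntermediateField.adjoin ℚ ({β} : Set (AlgebraicClosure ℚ))) := IntermediateField.adjoin.finiteDimensional ((AlgebraicClosure.isAlgebraic ℚ).isAlgebraic β).isIntegral
    haveI : NumberField ↥(IntermediateField.adjoin ℚ ({β} : Set (AlgebraicClosure ℚ))) := NumberField.mk
    (Ideal.span {((7 : 𝓞 ↥(IntermediateField.adjoin ℚ ({β} : Set (AlgebraicClosure ℚ)))) + (14 : 𝓞 ↥(IntermediateField.adjoin ℚ ({β} : Set (AlgebraicClosure ℚ)))) * MonicCubic.thetaInt (aeval_theta_n25861 hβ) + (-10 : 𝓞 ↥(IntermediateField.adjoin ℚ ({β} : Set (AlgebraicClosure ℚ)))) * MonicCubic.thetaInt (CubicDisc2351.delta_root (aeval_theta_n25861 hβ)))}).IsMaximal := by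
  haveI : FiniteDimensional ℚ ↥(IntermediateField.adjoin ℚ ({β} : Set (AlgebraicClosure ℚ))) := IntermediateField.adjoin.finiteDimensional ((AlgebraicClosure.isAlgebraic ℚ).isAlgebraic β).isIntegral
  haveI : NumberField ↥(IntermediateField.adjoin ℚ ({β} : Set (AlgebraicClosure ℚ))) := NumberField.mk
  haveI : Fact (Nat.Prime 97) := ⟨by norm_num⟩
  have hθ := aeval_theta_n25861 hβ
  have h3 := finrank_cubicField_n25861 hβ
  obtain ⟨ψ, hψ⟩ := exists_residueHom_q hβ
  set θI : 𝓞 ↥(IntermediateField.adjoin ℚ ({β} : Set (AlgebraicClosure ℚ))) := MonicCubic.thetaInt hθ with hθI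
  set δI : 𝓞 ↥(IntermediateField.adjoin ℚ ({β} : Set (AlgebraicClosure ℚ))) := MonicCubic.thetaInt (CubicDisc2351.delta_root hθ) with hδI
  obtain ⟨hX2, hXY, hY2⟩ := CubicDisc2351.mul_table hθ
  rw [← hθI, ← hδI] at hX2 hXY hY2
  have hexp : ¬ 97 ∣ RingOfIntegers.exponent (MonicCubic.thetaInt hθ) := CubicDisc2351.not_dvd_exponent h3 hθ (by norm_num) (by norm_num)
  have hker := MonicCubic.ker_residueHom_eq_span CubicDisc2351.irreducible_polyQ hθ hexp ψ hψ
  have hspan : Ideal.span {((97 : ℕ) : 𝓞 ↥(IntermediateField.adjoin ℚ ({β} : Set (AlgebraicClosure ℚ)))), MonicCubic.thetaInt hθ - ((27 : ℤ) : 𝓞 ↥(IntermediateField.adjoin ℚ ({β} : Set (AlgebraicClosure ℚ))))} = Ideal.span {((7 : 𝓞 ↥(IntermediateField.adjoin ℚ ({β} : Set (AlgebraicClosure ℚ)))) + (14 : 𝓞 ↥(IntermediateField.adjoin ℚ ({β} : Set (AlgebraicClosure ℚ)))) * θI + (-10 : 𝓞 ↥(IntermediateField.adjoin ℚ ({β}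 : Set (AlgebraicClosure ℚ)))) * δI)} := by
    rw [← hθI]
    apply le_antisymm
    · rw [Ideal.span_le]
      intro x hx
      simp only [Set.mem_insert_iff, Set.mem_singleton_iff] at hx
      rcases hx with rfl | rfl
      · exact Ideal.mem_span_singleton'.mpr ⟨((2887 : 𝓞 ↥(IntermediateField.adjoin ℚ ({β} : Set (AlgebraicClosure ℚ)))) + (-1178 : 𝓞 ↥(IntermediateField.adjoin ℚ ({β} : Set (AlgebraicClosure ℚ)))) * θI + (422 : 𝓞 ↥(IntermediateField.adjoin ℚ ({β} : Set (AlgebraicClosure ℚ)))) * δI), by push_cast; linear_combination ((-16492 : 𝓞 ↥(IntermediateField.adjoin ℚ ({β} : Set (AlgebraicClosure ℚ))))) * hX2 + ((17688 : 𝓞 ↥(IntermediateField.adjoin ℚ ({β} : Set (AlgebraicClosure ℚ))))) * hXY + ((-4220 : 𝓞 ↥(IntermediateField.adjoin ℚ ({β} : Set (AlgebraicClosure ℚ))))) * hY2⟩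
      · exact Ideal.mem_span_singleton'.mpr ⟨((-821 : 𝓞 ↥(IntermediateField.adjoin ℚ ({β} : Set (AlgebraicClosure ℚ)))) + (335 : 𝓞 ↥(IntermediateField.adjoin ℚ ({β} : Set (AlgebraicClosure ℚ)))) * θI + (-120 : 𝓞 ↥(IntermediateField.adjoin ℚ ({β} : Set (AlgebraicClosure ℚ)))) * δI), by push_cast; linear_combination ((4690 : 𝓞 ↥(IntermediateField.adjoin ℚ ({β} : Set (AlgebraicClosure ℚ))))) * hX2 + ((-5030 : 𝓞 ↥(IntermediateField.adjoin ℚ ({β} : Set (AlgebraicClosure ℚ))))) * hXY + ((1200 : 𝓞 ↥(IntermediateField.adjoin ℚ ({β} : Set (AlgebraicClosure ℚ))))) * hY2⟩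
    · rw [Ideal.span_singleton_le_iff_mem, Ideal.mem_span_pair]
      exact ⟨((-1 : 𝓞 ↥(IntermediateField.adjoin ℚ ({β} : Set (AlgebraicClosure ℚ)))) + (2 : 𝓞 ↥(IntermediateField.adjoin ℚ ({β} : Set (AlgebraicClosure ℚ)))) * θI + (0 : 𝓞 ↥(IntermediateField.adjoin ℚ ({β} : Set (AlgebraicClosure ℚ)))) * δI), ((-4 : 𝓞 ↥(IntermediateField.adjoin ℚ ({β} : Set (AlgebraicClosure ℚ)))) + (6 : 𝓞 ↥(IntermediateField.adjoin ℚ ({β} : Set (AlgebraicClosure ℚ)))) * θI + (1 : 𝓞 ↥(IntermediateField.adjoin ℚ ({β} : Set (AlgebraicClosure ℚ)))) * δI), by push_cast; linear_combination ((6 : 𝓞 ↥(IntermediateField.adjoin ℚ ({β} : Set (AlgebraicClosure ℚ))))) * hX2 + ((1 : 𝓞 ↥(IntermediateField.adjoin ℚ ({β} : Set (AlgebraicClosure ℚ))))) * hXY + ((0 : 𝓞 ↥(IntermediateField.adjoin ℚ ({β} : Set (AlgebraicClosure ℚ))))) * hY2⟩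
  rw [← hspan, ← hker]
  exact ker_zmod_isMaximal ψ

/-! ## §2 ★★★ The relation row at layer two on the split stratum: `rank₂ ≤ 2`, `μ₂ = 0`, `λ₂ ≤ 2` — UNCONDITIONAL -/

set_option maxHeartbeats 4000000 in
/-- ★★★ **`rank₂ Cl(K_m) ≤ 2 ∀ m`, `μ₂ = 0`, `λ₂ ≤ 2` — UNCONDITIONAL — for every cyclotomic `ℤ₂`-extension of the cubic `2`-torsion field of `⟨1, -1, 0, -31, -64⟩`**
(`N = 25861`, split stratum, cubic field `−2351`): the split-stratum layer-two relation door in coordinates with the datum `q₀ = 7 + 14 * θ - 10 * δ` (norm `97`), `t = 4`,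
`y` (blocks on `1, s₁, s₂, s₁s₂`), `N(y) = ε_y q₀⁴`, square and comaximality witnesses; the unit `ε = -819 - 1548 * θ + 710 * δ` is `≡ ±1 (mod 𝔭₁³)` and `≡ ±3 (mod 𝔭'³)`.
[cite: Washington1997, §13.3 Lemmas 13.15, 13.18, Prop. 13.22–13.23] [cite: Lang1990, Ch. 13 §4 Lemma 4.1] [cite: Fukuda1994, Thm. 1, p. 264] [cite: Cohen1993, §6.5]
[cite: LMFDB, number field 3.1.2351.1] -/
theorem classGroupPRank_le_two_and_mu_lambda_cubicField_n25861 {β : AlgebraicClosure ℚ} (hβ : aeval β ((⟨1, -1, 0, -31, -64⟩ : WeierstrassCurve ℤ).baseChange ℚ).twoTorsionPolynomial.toPoly = 0)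
    (κP : ZpExtension ↥(IntermediateField.adjoin ℚ ({β} : Set (AlgebraicClosure ℚ))) 2) (hκP : κP.IsCyclotomic) :
    (∀ m, classGroupPRank κP m ≤ 2) ∧ ClassicalMuVanishes κP ∧ classicalLambda κP ≤ 2 := by
  haveI := isElliptic_n25861
  haveI := isGloballyMinimal_n25861
  haveI : FiniteDimensional ℚ ↥(IntermediateField.adjoin ℚ ({β} : Set (AlgebraicClosure ℚ))) := IntermediateField.adjoin.finiteDimensional ((AlgebraicClosure.isAlgebraic ℚ).isAlgebraic β).isIntegral
  haveI : NumberField ↥(IntermediateField.adjoin ℚ ({β} : Set (AlgebraicClosure ℚ))) := NumberField.mk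
  have hord : IsOrdinaryAt ((⟨1, -1, 0, -31, -64⟩ : WeierstrassCurve ℤ).baseChange ℚ) 2 := goodOrd_two_n25861
  have ht := not_hasRationalTwoTorsionX_n25861
  have hθ := aeval_theta_n25861 hβ
  have h3 := finrank_cubicField_n25861 hβ
  have hd : ¬ (2 : ℤ) ∣ NumberField.discr ↥(IntermediateField.adjoin ℚ ({β} : Set (AlgebraicClosure ℚ))) := by
    rw [CubicDisc2351.discr_eq h3 hθ]; norm_num
  obtain ⟨ψ, hψ⟩ := exists_residueHom_q hβ
  obtain ⟨χ, hχ⟩ := exists_residueHom_chi hβ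
  have hmax := isMaximal_span_q0_n25861 hβ
  have hN1 := absNorm_span_pi1_n25861 hβ
  have hN' := absNorm_span_pip_n25861 hβ
  set θI : 𝓞 ↥(IntermediateField.adjoin ℚ ({β} : Set (AlgebraicClosure ℚ))) := MonicCubic.thetaInt hθ with hθI
  set δI : 𝓞 ↥(IntermediateField.adjoin ℚ ({β} : Set (AlgebraicClosure ℚ))) := MonicCubic.thetaInt (CubicDisc2351.delta_root hθ) with hδI
  obtain ⟨hX2, hXY, hY2⟩ := CubicDisc2351.mul_table hθ
  have hden := CubicDisc2351.den_delta hθ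
  rw [← hθI, ← hδI] at hX2 hXY hY2 hden
  -- residues of `δ`
  have hψδ : ψ δI = (87 : ZMod 97) := by
    have h := congrArg ψ hden
    simp only [map_mul, map_add, map_pow, map_one, map_ofNat, hψ] at h
    have h9 : (49 : ZMod 97) * 2 = 1 := by decide
    calc ψ δI = ((49 : ZMod 97) * 2) * ψ δI := by rw [h9, one_mul]
      _ = (49 : ZMod 97) * (2 * ψ δI) := by ring
      _ = (87 : ZMod 97) := by rw [h]; decide
  have hχδ : χ δI = (10 : ZMod 13) := by
    have h := congrArg χ hden
    simp only [map_mul, map_add, map_pow, map_one, map_ofNat, hχ] at h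
    have h9 : (7 : ZMod 13) * 2 = 1 := by decide
    calc χ δI = ((7 : ZMod 13) * 2) * χ δI := by rw [h9, one_mul]
      _ = (7 : ZMod 13) * (2 * χ δI) := by ring
      _ = (10 : ZMod 13) := by rw [h]; decide
  -- the unit `ε` and its inverse; `±ε` non-squares (at `χ`)
  have hεmul : ((-819 : 𝓞 ↥(IntermediateField.adjoin ℚ ({β} : Set (AlgebraicClosure ℚ)))) + (-1548 : 𝓞 ↥(IntermediateField.adjoin ℚ ({β} : Set (AlgebraicClosure ℚ)))) * θI + (710 : 𝓞 ↥(IntermediateField.adjoin ℚ ({β} : Set (AlgebraicClosure ℚ)))) * δI) * ((-19238283 : 𝓞 ↥(IntermediateField.adjoin ℚ ({β} : Set (AlgebraicClosure ℚ)))) + (7853332 : 𝓞 ↥(IntermediateField.adjoin ℚ ({β} : Set (AlgebraicClosure ℚ)))) * θI + (-2812418 : 𝓞 ↥(IntermediateField.adjoin ℚ ({β} : Set (AlgebraicClosure ℚ)))) * δI) = 1 := by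
    linear_combination ((-12156957936 : 𝓞 ↥(IntermediateField.adjoin ℚ ({β} : Set (AlgebraicClosure ℚ))))) * hX2 + ((9929488784 : 𝓞 ↥(IntermediateField.adjoin ℚ ({β} : Set (AlgebraicClosure ℚ))))) * hXY + ((-1996816780 : 𝓞 ↥(IntermediateField.adjoin ℚ ({β} : Set (AlgebraicClosure ℚ))))) * hY2
  have hχε : χ ((-819 : 𝓞 ↥(IntermediateField.adjoin ℚ ({β} : Set (AlgebraicClosure ℚ)))) + (-1548 : 𝓞 ↥(IntermediateField.adjoin ℚ ({β} : Set (AlgebraicClosure ℚ)))) * θI + (710 : 𝓞 ↥(IntermediateField.adjoin ℚ ({β} : Set (AlgebraicClosure ℚ)))) * δI) = (11 : ZMod 13) := by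
    simp only [map_add, map_mul, map_neg, map_ofNat, hχ, hχδ]; push_cast; decide
  have hnsq : ∀ z : (𝓞 ↥(IntermediateField.adjoin ℚ ({β} : Set (AlgebraicClosure ℚ))))ˣ, Units.mkOfMulEqOne _ _ hεmul ≠ z ^ 2 ∧ Units.mkOfMulEqOne _ _ hεmul ≠ -z ^ 2 := by
    intro z
    refine ⟨fun h => ?_, fun h => ?_⟩
    · have h' := congrArg (fun w : (𝓞 ↥(IntermediateField.adjoin ℚ ({β} : Set (AlgebraicClosure ℚ))))ˣ => χ (w : 𝓞 ↥(IntermediateField.adjoin ℚ ({β} : Set (AlgebraicClosure ℚ))))) h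
      simp only [Units.val_mkOfMulEqOne, Units.val_pow_eq_pow_val, map_pow] at h'
      rw [hχε] at h'
      exact absurd h'.symm (by generalize χ (z : 𝓞 ↥(IntermediateField.adjoin ℚ ({β} : Set (AlgebraicClosure ℚ)))) = u; revert u; decide)
    · have h' := congrArg (fun w : (𝓞 ↥(IntermediateField.adjoin ℚ ({β} : Set (AlgebraicClosure ℚ))))ˣ => χ (w : 𝓞 ↥(IntermediateField.adjoin ℚ ({β} : Set (AlgebraicClosure ℚ))))) h
      simp only [Units.val_mkOfMulEqOne, Units.val_neg, Units.val_pow_eq_pow_val, map_neg, map_pow] at h'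
      rw [hχε] at h'
      exact absurd h'.symm (by generalize χ (z : 𝓞 ↥(IntermediateField.adjoin ℚ ({β} : Set (AlgebraicClosure ℚ)))) = u; revert u; decide)
  -- congruences at the dyadic primes
  have hε : (Units.mkOfMulEqOne _ _ hεmul : (𝓞 ↥(IntermediateField.adjoin ℚ ({β} : Set (AlgebraicClosure ℚ))))ˣ).val - 1 ∈ Ideal.span {((1 : 𝓞 ↥(IntermediateField.adjoin ℚ ({β} : Set (AlgebraicClosure ℚ)))) + (2 : 𝓞 ↥(IntermediateField.adjoin ℚ ({β} : Set (AlgebraicClosure ℚ)))) * θI + (-1 : 𝓞 ↥(IntermediateField.adjoin ℚ ({β} : Set (AlgebraicClosure ℚ)))) * δI)} ^ 3 ∨ (Units.mkOfMulEqOne _ _ hεmul : (𝓞 ↥(IntermediateField.adjoin ℚ ({β} : Set (AlgebraicClosure ℚ))))ˣ).val + 1 ∈ Ideal.span {((1 : 𝓞 ↥(IntermediateField.adjoin ℚ ({β} : Set (AlgebraicClosure ℚ)))) + (2 : 𝓞 ↥(IntermediateField.adjoin ℚ ({β} : Set (AlgebraicClosure ℚ)))) * θI + (-1 : 𝓞 ↥(IntermediateField.adjoin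 ℚ ({β} : Set (AlgebraicClosure ℚ)))) * δI)} ^ 3 := by
    refine Or.inr ?_
    rw [Units.val_mkOfMulEqOne, Ideal.span_singleton_pow, Ideal.mem_span_singleton']
    exact ⟨((-7362 : 𝓞 ↥(IntermediateField.adjoin ℚ ({β} : Set (AlgebraicClosure ℚ)))) + (3000 : 𝓞 ↥(IntermediateField.adjoin ℚ ({β} : Set (AlgebraicClosure ℚ)))) * θI + (-1076 : 𝓞 ↥(IntermediateField.adjoin ℚ ({β} : Set (AlgebraicClosure ℚ)))) * δI), by linear_combination ((-23448 : 𝓞 ↥(IntermediateField.adjoin ℚ ({β} : Set (AlgebraicClosure ℚ)))) + (132040 : 𝓞 ↥(IntermediateField.adjoin ℚ ({β} : Set (AlgebraicClosure ℚ)))) * δI + (30912 : 𝓞 ↥(IntermediateField.adjoin ℚ ({β} : Set (AlgebraicClosure ℚ)))) * δI ^ 2 + (-46896 : 𝓞 ↥(IntermediateField.adjoin ℚ ({β} : Set (AlgebraicClosure ℚ)))) * θI + (-44608 : 𝓞 ↥(IntermediateField.adjoin ℚ ({β} : Set (AlgebraicClosure ℚ)))) * θI * δI + (24000 : 𝓞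 ↥(IntermediateField.adjoin ℚ ({β} : Set (AlgebraicClosure ℚ)))) * θI ^ 2) * hX2 + ((-6268 : 𝓞 ↥(IntermediateField.adjoin ℚ ({β} : Set (AlgebraicClosure ℚ)))) + (-90412 : 𝓞 ↥(IntermediateField.adjoin ℚ ({β} : Set (AlgebraicClosure ℚ)))) * δI + (-9456 : 𝓞 ↥(IntermediateField.adjoin ℚ ({β} : Set (AlgebraicClosure ℚ)))) * δI ^ 2) * hXY + ((1544 : 𝓞 ↥(IntermediateField.adjoin ℚ ({β} : Set (AlgebraicClosure ℚ)))) + (26210 : 𝓞 ↥(IntermediateField.adjoin ℚ ({β} : Set (AlgebraicClosure ℚ)))) * δI + (1076 : 𝓞 ↥(IntermediateField.adjoin ℚ ({β} : Set (AlgebraicClosure ℚ)))) * δI ^ 2) * hY2⟩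
  have hε' : (Units.mkOfMulEqOne _ _ hεmul : (𝓞 ↥(IntermediateField.adjoin ℚ ({β} : Set (AlgebraicClosure ℚ))))ˣ).val - 3 ∈ Ideal.span {((-3 : 𝓞 ↥(IntermediateField.adjoin ℚ ({β} : Set (AlgebraicClosure ℚ)))) + (-7 : 𝓞 ↥(IntermediateField.adjoin ℚ ({β} : Set (AlgebraicClosure ℚ)))) * θI + (9 : 𝓞 ↥(IntermediateField.adjoin ℚ ({β} : Set (AlgebraicClosure ℚ)))) * δI)} ^ 3 ∨ (Units.mkOfMulEqOne _ _ hεmul : (𝓞 ↥(IntermediateField.adjoin ℚ ({β} : Set (AlgebraicClosure ℚ))))ˣ).val + 3 ∈ Ideal.span {((-3 : 𝓞 ↥(IntermediateField.adjoin ℚ ({β} : Set (AlgebraicClosure ℚ)))) + (-7 : 𝓞 ↥(IntermediateField.adjoin ℚ ({β} : Set (AlgebraicClosure ℚ)))) * θI + (9 : 𝓞 ↥(IntermediateField.adjoin ℚ ({β} : Set (AlgebraicClosure ℚ)))) * δI)} ^ 3 := by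
    refine Or.inr ?_
    rw [Units.val_mkOfMulEqOne, Ideal.span_singleton_pow, Ideal.mem_span_singleton']
    exact ⟨((11027805520 : 𝓞 ↥(IntermediateField.adjoin ℚ ({β} : Set (AlgebraicClosure ℚ)))) + (-4501702048 : 𝓞 ↥(IntermediateField.adjoin ℚ ({β} : Set (AlgebraicClosure ℚ)))) * θI + (1612139646 : 𝓞 ↥(IntermediateField.adjoin ℚ ({β} : Set (AlgebraicClosure ℚ)))) * δI), by linear_combination ((-671070054592 : 𝓞 ↥(IntermediateField.adjoin ℚ ({β} : Set (AlgebraicClosure ℚ)))) + (18370786309652 : 𝓞 ↥(IntermediateField.adjoin ℚ ({β} : Set (AlgebraicClosure ℚ)))) * δI + (9790255935306 : 𝓞 ↥(IntermediateField.adjoin ℚ ({β} : Set (AlgebraicClosure ℚ)))) * δI ^ 2 + (-3341370492656 : 𝓞 ↥(IntermediateField.adjoin ℚ ({β} : Set (AlgebraicClosure ℚ)))) * θI + (-6508715708082 : 𝓞 ↥(IntermediateField.adjoin ℚ ({β} : Set (AlgebraicClosure ℚ)))) * θI * δI + (1544083802464 : 𝓞 ↥(IntermediateField.adjoin ℚ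 ({β} : Set (AlgebraicClosure ℚ)))) * θI ^ 2) * hX2 + ((-1118644290150 : 𝓞 ↥(IntermediateField.adjoin ℚ ({β} : Set (AlgebraicClosure ℚ)))) + (-14119650385278 : 𝓞 ↥(IntermediateField.adjoin ℚ ({β} : Set (AlgebraicClosure ℚ)))) * δI + (-6023990330838 : 𝓞 ↥(IntermediateField.adjoin ℚ ({β} : Set (AlgebraicClosure ℚ)))) * δI ^ 2) * hXY + ((348068867698 : 𝓞 ↥(IntermediateField.adjoin ℚ ({β} : Set (AlgebraicClosure ℚ)))) + (4551329252106 : 𝓞 ↥(IntermediateField.adjoin ℚ ({β} : Set (AlgebraicClosure ℚ)))) * δI + (1175249801934 : 𝓞 ↥(IntermediateField.adjoin ℚ ({β} : Set (AlgebraicClosure ℚ)))) * δI ^ 2) * hY2⟩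
  have hπ : ((7 : 𝓞 ↥(IntermediateField.adjoin ℚ ({β} : Set (AlgebraicClosure ℚ)))) + (14 : 𝓞 ↥(IntermediateField.adjoin ℚ ({β} : Set (AlgebraicClosure ℚ)))) * θI + (-10 : 𝓞 ↥(IntermediateField.adjoin ℚ ({β} : Set (AlgebraicClosure ℚ)))) * δI) - 3 ∈ Ideal.span {((1 : 𝓞 ↥(IntermediateField.adjoin ℚ ({β} : Set (AlgebraicClosure ℚ)))) + (2 : 𝓞 ↥(IntermediateField.adjoin ℚ ({β} : Set (AlgebraicClosure ℚ)))) * θI + (-1 : 𝓞 ↥(IntermediateField.adjoin ℚ ({β} : Set (AlgebraicClosure ℚ)))) * δI)} ^ 3 ∨ ((7 : 𝓞 ↥(IntermediateField.adjoin ℚ ({β} : Set (AlgebraicClosure ℚ)))) + (14 : 𝓞 ↥(IntermediateField.adjoin ℚ ({β} : Set (AlgebraicClosure ℚ)))) * θI + (-10 : 𝓞 ↥(IntermediateField.adjoin ℚ ({β} : Set (AlgebraicClosure ℚ)))) * δI) + 3 ∈ Ideal.span {((1 : 𝓞 ↥(IntermediateField.adjoin ℚ ({β} : Set (AlgebraicClosure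 ℚ)))) + (2 : 𝓞 ↥(IntermediateField.adjoin ℚ ({β} : Set (AlgebraicClosure ℚ)))) * θI + (-1 : 𝓞 ↥(IntermediateField.adjoin ℚ ({β} : Set (AlgebraicClosure ℚ)))) * δI)} ^ 3 := by
    refine Or.inl ?_
    rw [Ideal.span_singleton_pow, Ideal.mem_span_singleton']
    exact ⟨((21876 : 𝓞 ↥(IntermediateField.adjoin ℚ ({β} : Set (AlgebraicClosure ℚ)))) + (-8930 : 𝓞 ↥(IntermediateField.adjoin ℚ ({β} : Set (AlgebraicClosure ℚ)))) * θI + (3198 : 𝓞 ↥(IntermediateField.adjoin ℚ ({β} : Set (AlgebraicClosure ℚ)))) * δI), by linear_combination ((69644 : 𝓞 ↥(IntermediateField.adjoin ℚ ({β} : Set (AlgebraicClosure ℚ)))) + (-392600 : 𝓞 ↥(IntermediateField.adjoin ℚ ({β} : Set (AlgebraicClosure ℚ)))) * δI + (-91956 : 𝓞 ↥(IntermediateField.adjoin ℚ ({β} : Set (AlgebraicClosure ℚ)))) * δI ^ 2 + (139288 : 𝓞 ↥(IntermediateField.adjoin ℚ ({β} : Set (AlgebraicClosure ℚ)))) * θI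 + (132744 : 𝓞 ↥(IntermediateField.adjoin ℚ ({β} : Set (AlgebraicClosure ℚ)))) * θI * δI + (-71440 : 𝓞 ↥(IntermediateField.adjoin ℚ ({β} : Set (AlgebraicClosure ℚ)))) * θI ^ 2) * hX2 + ((18854 : 𝓞 ↥(IntermediateField.adjoin ℚ ({β} : Set (AlgebraicClosure ℚ)))) + (268946 : 𝓞 ↥(IntermediateField.adjoin ℚ ({β} : Set (AlgebraicClosure ℚ)))) * δI + (28118 : 𝓞 ↥(IntermediateField.adjoin ℚ ({β} : Set (AlgebraicClosure ℚ)))) * δI ^ 2) * hXY + ((-4462 : 𝓞 ↥(IntermediateField.adjoin ℚ ({β} : Set (AlgebraicClosure ℚ)))) + (-77990 : 𝓞 ↥(IntermediateField.adjoin ℚ ({β} : Set (AlgebraicClosure ℚ)))) * δI + (-3198 : 𝓞 ↥(IntermediateField.adjoin ℚ ({β} : Set (AlgebraicClosure ℚ)))) * δI ^ 2) * hY2⟩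
  have hψq : ψ ((7 : 𝓞 ↥(IntermediateField.adjoin ℚ ({β} : Set (AlgebraicClosure ℚ)))) + (14 : 𝓞 ↥(IntermediateField.adjoin ℚ ({β} : Set (AlgebraicClosure ℚ)))) * θI + (-10 : 𝓞 ↥(IntermediateField.adjoin ℚ ({β} : Set (AlgebraicClosure ℚ)))) * δI) = 0 := by
    simp only [map_add, map_mul, map_neg, map_ofNat, hψ, hψδ]; push_cast; decide
  have hεy : ((-1 : 𝓞 ↥(IntermediateField.adjoin ℚ ({β} : Set (AlgebraicClosure ℚ)))) + (0 : 𝓞 ↥(IntermediateField.adjoin ℚ ({β} : Set (AlgebraicClosure ℚ)))) * θI + (0 : 𝓞 ↥(IntermediateField.adjoin ℚ ({β} : Set (AlgebraicClosure ℚ)))) * δI) * ((-1 : 𝓞 ↥(IntermediateField.adjoin ℚ ({β} : Set (AlgebraicClosure ℚ)))) + (0 : 𝓞 ↥(IntermediateField.adjoin ℚ ({β} : Set (AlgebraicClosure ℚ)))) * θI + (0 : 𝓞 ↥(IntermediateField.adjoin ℚ ({β} : Set (AlgebraicClosure ℚ)))) * δI) = 1 := by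
    linear_combination ((0 : 𝓞 ↥(IntermediateField.adjoin ℚ ({β} : Set (AlgebraicClosure ℚ))))) * hX2 + ((0 : 𝓞 ↥(IntermediateField.adjoin ℚ ({β} : Set (AlgebraicClosure ℚ))))) * hXY + ((0 : 𝓞 ↥(IntermediateField.adjoin ℚ ({β} : Set (AlgebraicClosure ℚ))))) * hY2
  exact AlignedTransportAtTwoCubicSplitStratumLayerTwoRelationDoor.classicalMuVanishes_adjoin_of_relationCert_layer_two_splitStratum ((⟨1, -1, 0, -31, -64⟩ : WeierstrassCurve ℤ).baseChange ℚ) hord ht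
    minimalDiscriminantInt_emod_eight_n25861 Δ_n25861_neg hβ (not_two_dvd_classNumber_cubicField_n25861 hβ) hd
    (Ideal.span {((-3 : 𝓞 ↥(IntermediateField.adjoin ℚ ({β} : Set (AlgebraicClosure ℚ)))) + (-7 : 𝓞 ↥(IntermediateField.adjoin ℚ ({β} : Set (AlgebraicClosure ℚ)))) * θI + (9 : 𝓞 ↥(IntermediateField.adjoin ℚ ({β} : Set (AlgebraicClosure ℚ)))) * δI)}) hN' hε' (Ideal.span {((1 : 𝓞 ↥(IntermediateField.adjoin ℚ ({β} : Set (AlgebraicClosure ℚ)))) + (2 : 𝓞 ↥(IntermediateField.adjoin ℚ ({β} : Set (AlgebraicClosure ℚ)))) * θI + (-1 : 𝓞 ↥(IntermediateField.adjoin ℚ ({β} : Set (AlgebraicClosure ℚ)))) * δI)}) hN1 hε hnsq κP hκP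
    ((7 : 𝓞 ↥(IntermediateField.adjoin ℚ ({β} : Set (AlgebraicClosure ℚ)))) + (14 : 𝓞 ↥(IntermediateField.adjoin ℚ ({β} : Set (AlgebraicClosure ℚ)))) * θI + (-10 : 𝓞 ↥(IntermediateField.adjoin ℚ ({β} : Set (AlgebraicClosure ℚ)))) * δI) hmax hπ 4 (q := 97) (by norm_num) ψ hψq (ti := 49) (by decide) (by decide)
    ((8728414666383637861107948655975 : 𝓞 ↥(IntermediateField.adjoin ℚ ({β} : Set (AlgebraicClosure ℚ)))) + (-3563059042748316784700448195704 : 𝓞 ↥(IntermediateField.adjoin ℚ ({β} : Set (AlgebraicClosure ℚ)))) * θI + (1275994875416404095768862791624 : 𝓞 ↥(IntermediateField.adjoin ℚ ({β} : Set (AlgebraicClosure ℚ)))) * δI) ((13587348899354793206810248210192 : 𝓞 ↥(IntermediateField.adjoin ℚ ({β} : Set (AlgebraicClosure ℚ)))) + (26310100921163867549740829409971 : 𝓞 ↥(IntermediateField.adjoin ℚ ({β} : Set (AlgebraicClosure ℚ)))) * θI + (-14806233669775820358718522878985 : 𝓞 ↥(IntermediateField.adjoin ℚ ({β} : Set (AlgebraicClosure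 ℚ)))) * δI) (by push_cast; linear_combination ((805081177554928990805647416318613375600 : 𝓞 ↥(IntermediateField.adjoin ℚ ({β} : Set (AlgebraicClosure ℚ)))) + (3347465200904928941554051339425060571904 : 𝓞 ↥(IntermediateField.adjoin ℚ ({β} : Set (AlgebraicClosure ℚ)))) * δI + (42494465373035059935179692610896926770368 : 𝓞 ↥(IntermediateField.adjoin ℚ ({β} : Set (AlgebraicClosure ℚ)))) * δI ^ 2 + (267498188837950814375152543340150393376256 : 𝓞 ↥(IntermediateField.adjoin ℚ ({β} : Set (AlgebraicClosure ℚ)))) * δI ^ 3 + (962530709529918306950192144137372851199232 : 𝓞 ↥(IntermediateField.adjoin ℚ ({β} : Set (AlgebraicClosure ℚ)))) * δI ^ 4 + (931643274345953151207264513006084400844800 : 𝓞 ↥(IntermediateField.adjoin ℚ ({β} : Set (AlgebraicClosure ℚ)))) * δI ^ 5 + (216226663598884770354270316136555792000000 : 𝓞 ↥(IntermediateField.adjoin ℚ ({β} : Set (AlgebraicClosure ℚ)))) * δI ^ 6 + (10993286004163340476444020979620992000000 : 𝓞 ↥(IntermediateField.adjoin ℚ ({β} : Set (AlgebraicClosure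 ℚ)))) * δI ^ 7 + (4501841844006461315253757642566998415136 : 𝓞 ↥(IntermediateField.adjoin ℚ ({β} : Set (AlgebraicClosure ℚ)))) * θI + (-16062198552644937537863110880330353654144 : 𝓞 ↥(IntermediateField.adjoin ℚ ({β} : Set (AlgebraicClosure ℚ)))) * θI * δI + (-9348480944213757190254523137622557978368 : 𝓞 ↥(IntermediateField.adjoin ℚ ({β} : Set (AlgebraicClosure ℚ)))) * θI * δI ^ 2 + (-256290827729110469788565437986806497478656 : 𝓞 ↥(IntermediateField.adjoin ℚ ({β} : Set (AlgebraicClosure ℚ)))) * θI * δI ^ 3 + (-559790157538980932955110452011630669893120 : 𝓞 ↥(IntermediateField.adjoin ℚ ({β} : Set (AlgebraicClosure ℚ)))) * θI * δI ^ 4 + (-340926643961289769167165241137200019712000 : 𝓞 ↥(IntermediateField.adjoin ℚ ({β} : Set (AlgebraicClosure ℚ)))) * θI * δI ^ 5 + (-39161515680201394411658712899234585600000 : 𝓞 ↥(IntermediateField.adjoin ℚ ({β} : Set (AlgebraicClosure ℚ)))) * θI * δI ^ 6 + (15739914578269762020243482026941403232416 : 𝓞 ↥(IntermediateField.adjoin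 ℚ ({β} : Set (AlgebraicClosure ℚ)))) * θI ^ 2 + (-59112496644757553369675979407762989575680 : 𝓞 ↥(IntermediateField.adjoin ℚ ({β} : Set (AlgebraicClosure ℚ)))) * θI ^ 2 * δI + (140528308583046661013701560873876350124800 : 𝓞 ↥(IntermediateField.adjoin ℚ ({β} : Set (AlgebraicClosure ℚ)))) * θI ^ 2 * δI ^ 2 + (73304974346223633313853217691267268013056 : 𝓞 ↥(IntermediateField.adjoin ℚ ({β} : Set (AlgebraicClosure ℚ)))) * θI ^ 2 * δI ^ 3 + (349685002066188735636483927595308659366400 : 𝓞 ↥(IntermediateField.adjoin ℚ ({β} : Set (AlgebraicClosure ℚ)))) * θI ^ 2 * δI ^ 4 + (89064423868285340860560610256585254400000 : 𝓞 ↥(IntermediateField.adjoin ℚ ({β} : Set (AlgebraicClosure ℚ)))) * θI ^ 2 * δI ^ 5 + (31413701653528113707908285165710441582592 : 𝓞 ↥(IntermediateField.adjoin ℚ ({β} : Set (AlgebraicClosure ℚ)))) * θI ^ 3 + (-117451921314728613495711396566234091344384 : 𝓞 ↥(IntermediateField.adjoin ℚ ({β} : Set (AlgebraicClosure ℚ))))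 * θI ^ 3 * δI + (136414409518705408065267851304509567283200 : 𝓞 ↥(IntermediateField.adjoin ℚ ({β} : Set (AlgebraicClosure ℚ)))) * θI ^ 3 * δI ^ 2 + (-219870675463969980721191311372512339343360 : 𝓞 ↥(IntermediateField.adjoin ℚ ({β} : Set (AlgebraicClosure ℚ)))) * θI ^ 3 * δI ^ 3 + (-134245530731406854839293092794689030656000 : 𝓞 ↥(IntermediateField.adjoin ℚ ({β} : Set (AlgebraicClosure ℚ)))) * θI ^ 3 * δI ^ 4 + (35750224740006049191715345587846527792128 : 𝓞 ↥(IntermediateField.adjoin ℚ ({β} : Set (AlgebraicClosure ℚ)))) * θI ^ 4 + (-89126055757916195475997861352249831155200 : 𝓞 ↥(IntermediateField.adjoin ℚ ({β} : Set (AlgebraicClosure ℚ)))) * θI ^ 4 * δI + (70740645957067350322570804727397401678848 : 𝓞 ↥(IntermediateField.adjoin ℚ ({β} : Set (AlgebraicClosure ℚ)))) * θI ^ 4 * δI ^ 2 + (134214143510733283642214575814814791475200 : 𝓞 ↥(IntermediateField.adjoin ℚ ({β} : Set (AlgebraicClosure ℚ)))) * θI ^ 4 * δI ^ 3 + (17610602357957383265542957241233804367104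 : 𝓞 ↥(IntermediateField.adjoin ℚ ({β} : Set (AlgebraicClosure ℚ)))) * θI ^ 5 + (-3355863481266815865395036801042841378816 : 𝓞 ↥(IntermediateField.adjoin ℚ ({β} : Set (AlgebraicClosure ℚ)))) * θI ^ 5 * δI + (-85879475003292101660653359012751892602880 : 𝓞 ↥(IntermediateField.adjoin ℚ ({β} : Set (AlgebraicClosure ℚ)))) * θI ^ 5 * δI ^ 2 + (-2893671782630542366955730395446914236672 : 𝓞 ↥(IntermediateField.adjoin ℚ ({β} : Set (AlgebraicClosure ℚ)))) * θI ^ 6 + (31930662365050481597592290387815218612224 : 𝓞 ↥(IntermediateField.adjoin ℚ ({β} : Set (AlgebraicClosure ℚ)))) * θI ^ 6 * δI + (-5258323541169802073282029685514909415424 : 𝓞 ↥(IntermediateField.adjoin ℚ ({β} : Set (AlgebraicClosure ℚ)))) * θI ^ 7) * hX2 + ((-169183409502564976414576401054387432160 : 𝓞 ↥(IntermediateField.adjoin ℚ ({β} : Set (AlgebraicClosure ℚ)))) + (-4516255775047085199273248063044354656832 : 𝓞 ↥(IntermediateField.adjoin ℚ ({β} : Set (AlgebraicClosure ℚ)))) *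 δI + (-50721426910344005926603929483266767630208 : 𝓞 ↥(IntermediateField.adjoin ℚ ({β} : Set (AlgebraicClosure ℚ)))) * δI ^ 2 + (-296267065759561907509078242461959490055424 : 𝓞 ↥(IntermediateField.adjoin ℚ ({β} : Set (AlgebraicClosure ℚ)))) * δI ^ 3 + (-811151963954956060107886972205037226839040 : 𝓞 ↥(IntermediateField.adjoin ℚ ({β} : Set (AlgebraicClosure ℚ)))) * δI ^ 4 + (-551269487053757804204618396437717193024000 : 𝓞 ↥(IntermediateField.adjoin ℚ ({β} : Set (AlgebraicClosure ℚ)))) * δI ^ 5 + (-78617996258677975512032708254813971200000 : 𝓞 ↥(IntermediateField.adjoin ℚ ({β} : Set (AlgebraicClosure ℚ)))) * δI ^ 6 + (-1785420164741204265731171146189280000000 : 𝓞 ↥(IntermediateField.adjoin ℚ ({β} : Set (AlgebraicClosure ℚ)))) * δI ^ 7) * hXY + ((60587820629427453534461724077134653488 : 𝓞 ↥(IntermediateField.adjoin ℚ ({β} : Set (AlgebraicClosure ℚ)))) + (1557139846029001922883928843656684961824 : 𝓞 ↥(IntermediateField.adjoin ℚ ({β} : Set (AlgebraicClosure ℚ))))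 * δI + (16719164438129022464630953974717494493600 : 𝓞 ↥(IntermediateField.adjoin ℚ ({β} : Set (AlgebraicClosure ℚ)))) * δI ^ 2 + (93677690921321912282392521237437524286464 : 𝓞 ↥(IntermediateField.adjoin ℚ ({β} : Set (AlgebraicClosure ℚ)))) * δI ^ 3 + (245896872255837396591503141639626702169600 : 𝓞 ↥(IntermediateField.adjoin ℚ ({β} : Set (AlgebraicClosure ℚ)))) * δI ^ 4 + (140613249005462504399807921929655284000000 : 𝓞 ↥(IntermediateField.adjoin ℚ ({β} : Set (AlgebraicClosure ℚ)))) * δI ^ 5 + (14110951933817319983750621884720444000000 : 𝓞 ↥(IntermediateField.adjoin ℚ ({β} : Set (AlgebraicClosure ℚ)))) * δI ^ 6 + (127599487541640409576886279162400000000 : 𝓞 ↥(IntermediateField.adjoin ℚ ({β} : Set (AlgebraicClosure ℚ)))) * δI ^ 7) * hY2)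
    ((10174689 : 𝓞 ↥(IntermediateField.adjoin ℚ ({β} : Set (AlgebraicClosure ℚ)))) + (-4153448 : 𝓞 ↥(IntermediateField.adjoin ℚ ({β} : Set (AlgebraicClosure ℚ)))) * θI + (1487424 : 𝓞 ↥(IntermediateField.adjoin ℚ ({β} : Set (AlgebraicClosure ℚ)))) * δI) ((-1176 : 𝓞 ↥(IntermediateField.adjoin ℚ ({β} : Set (AlgebraicClosure ℚ))))) (by push_cast; linear_combination ((1994239044 : 𝓞 ↥(IntermediateField.adjoin ℚ ({β} : Set (AlgebraicClosure ℚ)))) + (1454500544 : 𝓞 ↥(IntermediateField.adjoin ℚ ({β} : Set (AlgebraicClosure ℚ)))) * δI + (-814075808 : 𝓞 ↥(IntermediateField.adjoin ℚ ({β} : Set (AlgebraicClosure ℚ)))) * θI) * hX2 + ((-1676291896 : 𝓞 ↥(IntermediateField.adjoin ℚ ({β} : Set (AlgebraicClosure ℚ)))) + (-831823520 : 𝓞 ↥(IntermediateField.adjoin ℚ ({β} : Set (AlgebraicClosure ℚ)))) * δI) * hXY + ((600309828 : 𝓞 ↥(IntermediateField.adjoin ℚ ({β} : Set (AlgebraicClosure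 ℚ)))) + (148742400 : 𝓞 ↥(IntermediateField.adjoin ℚ ({β} : Set (AlgebraicClosure ℚ)))) * δI) * hY2)
    ((-67 : 𝓞 ↥(IntermediateField.adjoin ℚ ({β} : Set (AlgebraicClosure ℚ)))) + (28 : 𝓞 ↥(IntermediateField.adjoin ℚ ({β} : Set (AlgebraicClosure ℚ)))) * θI + (-10 : 𝓞 ↥(IntermediateField.adjoin ℚ ({β} : Set (AlgebraicClosure ℚ)))) * δI) ((1 : 𝓞 ↥(IntermediateField.adjoin ℚ ({β} : Set (AlgebraicClosure ℚ)))) + (0 : 𝓞 ↥(IntermediateField.adjoin ℚ ({β} : Set (AlgebraicClosure ℚ)))) * θI + (0 : 𝓞 ↥(IntermediateField.adjoin ℚ ({β} : Set (AlgebraicClosure ℚ)))) * δI) ((-1 : 𝓞 ↥(IntermediateField.adjoin ℚ ({β} : Set (AlgebraicClosure ℚ)))) + (0 : 𝓞 ↥(IntermediateField.adjoin ℚ ({β} : Set (AlgebraicClosure ℚ)))) * θI + (0 : 𝓞 ↥(IntermediateField.adjoin ℚ ({β} : Set (AlgebraicClosure ℚ)))) * δI) ((-1 : 𝓞 ↥(IntermediateField.adjoin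 ℚ ({β} : Set (AlgebraicClosure ℚ)))) + (0 : 𝓞 ↥(IntermediateField.adjoin ℚ ({β} : Set (AlgebraicClosure ℚ)))) * θI + (0 : 𝓞 ↥(IntermediateField.adjoin ℚ ({β} : Set (AlgebraicClosure ℚ)))) * δI) ((145 : 𝓞 ↥(IntermediateField.adjoin ℚ ({β} : Set (AlgebraicClosure ℚ)))) + (40 : 𝓞 ↥(IntermediateField.adjoin ℚ ({β} : Set (AlgebraicClosure ℚ)))) * θI + (-134 : 𝓞 ↥(IntermediateField.adjoin ℚ ({β} : Set (AlgebraicClosure ℚ)))) * δI) ((102 : 𝓞 ↥(IntermediateField.adjoin ℚ ({β} : Set (AlgebraicClosure ℚ)))) + (-43 : 𝓞 ↥(IntermediateField.adjoin ℚ ({β} : Set (AlgebraicClosure ℚ)))) * θI + (-69 : 𝓞 ↥(IntermediateField.adjoin ℚ ({β} : Set (AlgebraicClosure ℚ)))) * δI) ((-136 : 𝓞 ↥(IntermediateField.adjoin ℚ ({β} : Set (AlgebraicClosure ℚ)))) + (23 : 𝓞 ↥(IntermediateField.adjoin ℚ ({β} : Set (AlgebraicClosure ℚ)))) * θI + (88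 : 𝓞 ↥(IntermediateField.adjoin ℚ ({β} : Set (AlgebraicClosure ℚ)))) * δI) ((-48 : 𝓞 ↥(IntermediateField.adjoin ℚ ({β} : Set (AlgebraicClosure ℚ)))) + (38 : 𝓞 ↥(IntermediateField.adjoin ℚ ({β} : Set (AlgebraicClosure ℚ)))) * θI + (86 : 𝓞 ↥(IntermediateField.adjoin ℚ ({β} : Set (AlgebraicClosure ℚ)))) * δI) ((55 : 𝓞 ↥(IntermediateField.adjoin ℚ ({β} : Set (AlgebraicClosure ℚ)))) + (77 : 𝓞 ↥(IntermediateField.adjoin ℚ ({β} : Set (AlgebraicClosure ℚ)))) * θI + (82 : 𝓞 ↥(IntermediateField.adjoin ℚ ({β} : Set (AlgebraicClosure ℚ)))) * δI) ((3 : 𝓞 ↥(IntermediateField.adjoin ℚ ({β} : Set (AlgebraicClosure ℚ)))) + (-3 : 𝓞 ↥(IntermediateField.adjoin ℚ ({β} : Set (AlgebraicClosure ℚ)))) * θI + (39 : 𝓞 ↥(IntermediateField.adjoin ℚ ({β} : Set (AlgebraicClosure ℚ)))) * δI) ((100 : 𝓞 ↥(IntermediateField.adjoin ℚ ({β} : Set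 (AlgebraicClosure ℚ)))) + (175 : 𝓞 ↥(IntermediateField.adjoin ℚ ({β} : Set (AlgebraicClosure ℚ)))) * θI + (-19 : 𝓞 ↥(IntermediateField.adjoin ℚ ({β} : Set (AlgebraicClosure ℚ)))) * δI) ((37 : 𝓞 ↥(IntermediateField.adjoin ℚ ({β} : Set (AlgebraicClosure ℚ)))) + (66 : 𝓞 ↥(IntermediateField.adjoin ℚ ({β} : Set (AlgebraicClosure ℚ)))) * θI + (-13 : 𝓞 ↥(IntermediateField.adjoin ℚ ({β} : Set (AlgebraicClosure ℚ)))) * δI)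
    (by push_cast; linear_combination ((-1419628 : 𝓞 ↥(IntermediateField.adjoin ℚ ({β} : Set (AlgebraicClosure ℚ)))) + (-2268896 : 𝓞 ↥(IntermediateField.adjoin ℚ ({β} : Set (AlgebraicClosure ℚ)))) * δI + (-14245280 : 𝓞 ↥(IntermediateField.adjoin ℚ ({β} : Set (AlgebraicClosure ℚ)))) * δI ^ 2 + (-2744000 : 𝓞 ↥(IntermediateField.adjoin ℚ ({β} : Set (AlgebraicClosure ℚ)))) * δI ^ 3 + (-2052512 : 𝓞 ↥(IntermediateField.adjoin ℚ ({β} : Set (AlgebraicClosure ℚ)))) * θI + (7584416 : 𝓞 ↥(IntermediateField.adjoin ℚ ({β} : Set (AlgebraicClosure ℚ)))) * θI * δI + (4390400 : 𝓞 ↥(IntermediateField.adjoin ℚ ({β} : Set (AlgebraicClosure ℚ)))) * θI * δI ^ 2 + (-1498224 : 𝓞 ↥(IntermediateField.adjoin ℚ ({β} : Set (AlgebraicClosure ℚ)))) * θI ^ 2 + (-3457440 : 𝓞 ↥(IntermediateField.adjoin ℚ ({β} : Set (AlgebraicClosure ℚ)))) * θI ^ 2 * δI + (1075648 : 𝓞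 ↥(IntermediateField.adjoin ℚ ({β} : Set (AlgebraicClosure ℚ)))) * θI ^ 3) * hX2 + ((627704 : 𝓞 ↥(IntermediateField.adjoin ℚ ({β} : Set (AlgebraicClosure ℚ)))) + (4916272 : 𝓞 ↥(IntermediateField.adjoin ℚ ({β} : Set (AlgebraicClosure ℚ)))) * δI + (8796800 : 𝓞 ↥(IntermediateField.adjoin ℚ ({β} : Set (AlgebraicClosure ℚ)))) * δI ^ 2 + (840000 : 𝓞 ↥(IntermediateField.adjoin ℚ ({β} : Set (AlgebraicClosure ℚ)))) * δI ^ 3) * hXY + ((-225372 : 𝓞 ↥(IntermediateField.adjoin ℚ ({β} : Set (AlgebraicClosure ℚ)))) + (-1659760 : 𝓞 ↥(IntermediateField.adjoin ℚ ({β} : Set (AlgebraicClosure ℚ)))) * δI + (-2378000 : 𝓞 ↥(IntermediateField.adjoin ℚ ({β} : Set (AlgebraicClosure ℚ)))) * δI ^ 2 + (-100000 : 𝓞 ↥(IntermediateField.adjoin ℚ ({β} : Set (AlgebraicClosure ℚ)))) * δI ^ 3) * hY2) (by push_cast; linear_combination ((-87416 : 𝓞 ↥(IntermediateField.adjoin ℚ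 ({β} : Set (AlgebraicClosure ℚ)))) + (38696 : 𝓞 ↥(IntermediateField.adjoin ℚ ({β} : Set (AlgebraicClosure ℚ)))) * δI + (117600 : 𝓞 ↥(IntermediateField.adjoin ℚ ({β} : Set (AlgebraicClosure ℚ)))) * δI ^ 2 + (76636 : 𝓞 ↥(IntermediateField.adjoin ℚ ({β} : Set (AlgebraicClosure ℚ)))) * θI + (-109760 : 𝓞 ↥(IntermediateField.adjoin ℚ ({β} : Set (AlgebraicClosure ℚ)))) * θI * δI + (38416 : 𝓞 ↥(IntermediateField.adjoin ℚ ({β} : Set (AlgebraicClosure ℚ)))) * θI ^ 2) * hX2 + ((80940 : 𝓞 ↥(IntermediateField.adjoin ℚ ({β} : Set (AlgebraicClosure ℚ)))) + (-73940 : 𝓞 ↥(IntermediateField.adjoin ℚ ({β} : Set (AlgebraicClosure ℚ)))) * δI + (-56000 : 𝓞 ↥(IntermediateField.adjoin ℚ ({β} : Set (AlgebraicClosure ℚ)))) * δI ^ 2) * hXY + ((-29068 : 𝓞 ↥(IntermediateField.adjoin ℚ ({β} : Set (AlgebraicClosure ℚ)))) + (33600 : 𝓞 ↥(IntermediateField.adjoin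 ℚ ({β} : Set (AlgebraicClosure ℚ)))) * δI + (10000 : 𝓞 ↥(IntermediateField.adjoin ℚ ({β} : Set (AlgebraicClosure ℚ)))) * δI ^ 2) * hY2) (by push_cast; linear_combination ((98980 : 𝓞 ↥(IntermediateField.adjoin ℚ ({β} : Set (AlgebraicClosure ℚ)))) + (-30688 : 𝓞 ↥(IntermediateField.adjoin ℚ ({β} : Set (AlgebraicClosure ℚ)))) * δI + (-117600 : 𝓞 ↥(IntermediateField.adjoin ℚ ({β} : Set (AlgebraicClosure ℚ)))) * δI ^ 2 + (-81144 : 𝓞 ↥(IntermediateField.adjoin ℚ ({β} : Set (AlgebraicClosure ℚ)))) * θI + (109760 : 𝓞 ↥(IntermediateField.adjoin ℚ ({β} : Set (AlgebraicClosure ℚ)))) * θI * δI + (-38416 : 𝓞 ↥(IntermediateField.adjoin ℚ ({β} : Set (AlgebraicClosure ℚ)))) * θI ^ 2) * hX2 + ((-90976 : 𝓞 ↥(IntermediateField.adjoin ℚ ({β} : Set (AlgebraicClosure ℚ)))) + (69400 : 𝓞 ↥(IntermediateField.adjoin ℚ ({β} : Set (AlgebraicClosure ℚ)))) * δI + (56000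 : 𝓞 ↥(IntermediateField.adjoin ℚ ({β} : Set (AlgebraicClosure ℚ)))) * δI ^ 2) * hXY + ((32764 : 𝓞 ↥(IntermediateField.adjoin ℚ ({β} : Set (AlgebraicClosure ℚ)))) + (-32800 : 𝓞 ↥(IntermediateField.adjoin ℚ ({β} : Set (AlgebraicClosure ℚ)))) * δI + (-10000 : 𝓞 ↥(IntermediateField.adjoin ℚ ({β} : Set (AlgebraicClosure ℚ)))) * δI ^ 2) * hY2) (by push_cast; linear_combination ((26852 : 𝓞 ↥(IntermediateField.adjoin ℚ ({β} : Set (AlgebraicClosure ℚ)))) + (-82796 : 𝓞 ↥(IntermediateField.adjoin ℚ ({β} : Set (AlgebraicClosure ℚ)))) * δI + (-117600 : 𝓞 ↥(IntermediateField.adjoin ℚ ({β} : Set (AlgebraicClosure ℚ)))) * δI ^ 2 + (-51940 : 𝓞 ↥(IntermediateField.adjoin ℚ ({β} : Set (AlgebraicClosure ℚ)))) * θI + (109760 : 𝓞 ↥(IntermediateField.adjoin ℚ ({β} : Set (AlgebraicClosure ℚ)))) * θI * δI + (-38416 : 𝓞 ↥(IntermediateField.adjoin ℚ ({β} : Set (AlgebraicClosure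 ℚ)))) * θI ^ 2) * hX2 + ((-29988 : 𝓞 ↥(IntermediateField.adjoin ℚ ({β} : Set (AlgebraicClosure ℚ)))) + (99140 : 𝓞 ↥(IntermediateField.adjoin ℚ ({β} : Set (AlgebraicClosure ℚ)))) * δI + (56000 : 𝓞 ↥(IntermediateField.adjoin ℚ ({β} : Set (AlgebraicClosure ℚ)))) * δI ^ 2) * hXY + ((10768 : 𝓞 ↥(IntermediateField.adjoin ℚ ({β} : Set (AlgebraicClosure ℚ)))) + (-38100 : 𝓞 ↥(IntermediateField.adjoin ℚ ({β} : Set (AlgebraicClosure ℚ)))) * δI + (-10000 : 𝓞 ↥(IntermediateField.adjoin ℚ ({β} : Set (AlgebraicClosure ℚ)))) * δI ^ 2) * hY2)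
    ((-1 : 𝓞 ↥(IntermediateField.adjoin ℚ ({β} : Set (AlgebraicClosure ℚ)))) + (0 : 𝓞 ↥(IntermediateField.adjoin ℚ ({β} : Set (AlgebraicClosure ℚ)))) * θI + (0 : 𝓞 ↥(IntermediateField.adjoin ℚ ({β} : Set (AlgebraicClosure ℚ)))) * δI) ((0 : 𝓞 ↥(IntermediateField.adjoin ℚ ({β} : Set (AlgebraicClosure ℚ)))) + (0 : 𝓞 ↥(IntermediateField.adjoin ℚ ({β} : Set (AlgebraicClosure ℚ)))) * θI + (0 : 𝓞 ↥(IntermediateField.adjoin ℚ ({β} : Set (AlgebraicClosure ℚ)))) * δI) ((0 : 𝓞 ↥(IntermediateField.adjoin ℚ ({β} : Set (AlgebraicClosure ℚ)))) + (0 : 𝓞 ↥(IntermediateField.adjoin ℚ ({β} : Set (AlgebraicClosure ℚ)))) * θI + (0 : 𝓞 ↥(IntermediateField.adjoin ℚ ({β} : Set (AlgebraicClosure ℚ)))) * δI) ((0 : 𝓞 ↥(IntermediateField.adjoin ℚ ({β} : Set (AlgebraicClosure ℚ)))) + (0 : 𝓞 ↥(IntermediateField.adjoin ℚ ({β} : Set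 (AlgebraicClosure ℚ)))) * θI + (0 : 𝓞 ↥(IntermediateField.adjoin ℚ ({β} : Set (AlgebraicClosure ℚ)))) * δI) ((-1 : 𝓞 ↥(IntermediateField.adjoin ℚ ({β} : Set (AlgebraicClosure ℚ)))) + (7 : 𝓞 ↥(IntermediateField.adjoin ℚ ({β} : Set (AlgebraicClosure ℚ)))) * θI + (-38 : 𝓞 ↥(IntermediateField.adjoin ℚ ({β} : Set (AlgebraicClosure ℚ)))) * δI) ((0 : 𝓞 ↥(IntermediateField.adjoin ℚ ({β} : Set (AlgebraicClosure ℚ)))) + (3 : 𝓞 ↥(IntermediateField.adjoin ℚ ({β} : Set (AlgebraicClosure ℚ)))) * θI + (-10 : 𝓞 ↥(IntermediateField.adjoin ℚ ({β} : Set (AlgebraicClosure ℚ)))) * δI) ((2 : 𝓞 ↥(IntermediateField.adjoin ℚ ({β} : Set (AlgebraicClosure ℚ)))) + (6 : 𝓞 ↥(IntermediateField.adjoin ℚ ({β} : Set (AlgebraicClosure ℚ)))) * θI + (21 : 𝓞 ↥(IntermediateField.adjoin ℚ ({β} : Set (AlgebraicClosure ℚ)))) * δI) ((0 : 𝓞 ↥(IntermediateField.adjoin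 ℚ ({β} : Set (AlgebraicClosure ℚ)))) + (4 : 𝓞 ↥(IntermediateField.adjoin ℚ ({β} : Set (AlgebraicClosure ℚ)))) * θI + (8 : 𝓞 ↥(IntermediateField.adjoin ℚ ({β} : Set (AlgebraicClosure ℚ)))) * δI) ((-1 : 𝓞 ↥(IntermediateField.adjoin ℚ ({β} : Set (AlgebraicClosure ℚ)))) + (-7 : 𝓞 ↥(IntermediateField.adjoin ℚ ({β} : Set (AlgebraicClosure ℚ)))) * θI + (-2 : 𝓞 ↥(IntermediateField.adjoin ℚ ({β} : Set (AlgebraicClosure ℚ)))) * δI) ((-1 : 𝓞 ↥(IntermediateField.adjoin ℚ ({β} : Set (AlgebraicClosure ℚ)))) + (-5 : 𝓞 ↥(IntermediateField.adjoin ℚ ({β} : Set (AlgebraicClosure ℚ)))) * θI + (-2 : 𝓞 ↥(IntermediateField.adjoin ℚ ({β} : Set (AlgebraicClosure ℚ)))) * δI) ((-2 : 𝓞 ↥(IntermediateField.adjoin ℚ ({β} : Set (AlgebraicClosure ℚ)))) + (-6 : 𝓞 ↥(IntermediateField.adjoin ℚ ({β} : Set (AlgebraicClosure ℚ)))) * θI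 + (-17 : 𝓞 ↥(IntermediateField.adjoin ℚ ({β} : Set (AlgebraicClosure ℚ)))) * δI) ((0 : 𝓞 ↥(IntermediateField.adjoin ℚ ({β} : Set (AlgebraicClosure ℚ)))) + (-4 : 𝓞 ↥(IntermediateField.adjoin ℚ ({β} : Set (AlgebraicClosure ℚ)))) * θI + (-6 : 𝓞 ↥(IntermediateField.adjoin ℚ ({β} : Set (AlgebraicClosure ℚ)))) * δI)
    (by push_cast; linear_combination ((-196 : 𝓞 ↥(IntermediateField.adjoin ℚ ({β} : Set (AlgebraicClosure ℚ))))) * hX2 + ((280 : 𝓞 ↥(IntermediateField.adjoin ℚ ({β} : Set (AlgebraicClosure ℚ))))) * hXY + ((-100 : 𝓞 ↥(IntermediateField.adjoin ℚ ({β} : Set (AlgebraicClosure ℚ))))) * hY2) (by push_cast; linear_combination ((0 : 𝓞 ↥(IntermediateField.adjoin ℚ ({β} : Set (AlgebraicClosure ℚ))))) * hX2 + ((0 : 𝓞 ↥(IntermediateField.adjoin ℚ ({β} : Set (AlgebraicClosure ℚ))))) * hXY + ((0 : 𝓞 ↥(IntermediateField.adjoin ℚ ({β} : Set (AlgebraicClosure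 ℚ))))) * hY2) (by push_cast; linear_combination ((0 : 𝓞 ↥(IntermediateField.adjoin ℚ ({β} : Set (AlgebraicClosure ℚ))))) * hX2 + ((0 : 𝓞 ↥(IntermediateField.adjoin ℚ ({β} : Set (AlgebraicClosure ℚ))))) * hXY + ((0 : 𝓞 ↥(IntermediateField.adjoin ℚ ({β} : Set (AlgebraicClosure ℚ))))) * hY2) (by push_cast; linear_combination ((0 : 𝓞 ↥(IntermediateField.adjoin ℚ ({β} : Set (AlgebraicClosure ℚ))))) * hX2 + ((0 : 𝓞 ↥(IntermediateField.adjoin ℚ ({β} : Set (AlgebraicClosure ℚ))))) * hXY + ((0 : 𝓞 ↥(IntermediateField.adjoin ℚ ({β} : Set (AlgebraicClosure ℚ))))) * hY2)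
    ((23 : 𝓞 ↥(IntermediateField.adjoin ℚ ({β} : Set (AlgebraicClosure ℚ)))) + (38 : 𝓞 ↥(IntermediateField.adjoin ℚ ({β} : Set (AlgebraicClosure ℚ)))) * θI + (-2 : 𝓞 ↥(IntermediateField.adjoin ℚ ({β} : Set (AlgebraicClosure ℚ)))) * δI) ((-5 : 𝓞 ↥(IntermediateField.adjoin ℚ ({β} : Set (AlgebraicClosure ℚ)))) + (-9 : 𝓞 ↥(IntermediateField.adjoin ℚ ({β} : Set (AlgebraicClosure ℚ)))) * θI + (-4 : 𝓞 ↥(IntermediateField.adjoin ℚ ({β} : Set (AlgebraicClosure ℚ)))) * δI) ((-15 : 𝓞 ↥(IntermediateField.adjoin ℚ ({β} : Set (AlgebraicClosure ℚ)))) + (-24 : 𝓞 ↥(IntermediateField.adjoin ℚ ({β} : Set (AlgebraicClosure ℚ)))) * θI + (-4 : 𝓞 ↥(IntermediateField.adjoin ℚ ({β} : Set (AlgebraicClosure ℚ)))) * δI) ((16 : 𝓞 ↥(IntermediateField.adjoin ℚ ({β} : Set (AlgebraicClosure ℚ)))) + (28 : 𝓞 ↥(IntermediateField.adjoin ℚ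 ({β} : Set (AlgebraicClosure ℚ)))) * θI + (0 : 𝓞 ↥(IntermediateField.adjoin ℚ ({β} : Set (AlgebraicClosure ℚ)))) * δI) ((-25 : 𝓞 ↥(IntermediateField.adjoin ℚ ({β} : Set (AlgebraicClosure ℚ)))) + (12 : 𝓞 ↥(IntermediateField.adjoin ℚ ({β} : Set (AlgebraicClosure ℚ)))) * θI + (-2 : 𝓞 ↥(IntermediateField.adjoin ℚ ({β} : Set (AlgebraicClosure ℚ)))) * δI) ((31 : 𝓞 ↥(IntermediateField.adjoin ℚ ({β} : Set (AlgebraicClosure ℚ)))) + (-17 : 𝓞 ↥(IntermediateField.adjoin ℚ ({β} : Set (AlgebraicClosure ℚ)))) * θI + (6 : 𝓞 ↥(IntermediateField.adjoin ℚ ({β} : Set (AlgebraicClosure ℚ)))) * δI) ((327 : 𝓞 ↥(IntermediateField.adjoin ℚ ({β} : Set (AlgebraicClosure ℚ)))) + (-130 : 𝓞 ↥(IntermediateField.adjoin ℚ ({β} : Set (AlgebraicClosure ℚ)))) * θI + (48 : 𝓞 ↥(IntermediateField.adjoin ℚ ({β} : Set (AlgebraicClosure ℚ)))) * δI) ((150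 : 𝓞 ↥(IntermediateField.adjoin ℚ ({β} : Set (AlgebraicClosure ℚ)))) + (-54 : 𝓞 ↥(IntermediateField.adjoin ℚ ({β} : Set (AlgebraicClosure ℚ)))) * θI + (18 : 𝓞 ↥(IntermediateField.adjoin ℚ ({β} : Set (AlgebraicClosure ℚ)))) * δI) ((-32 : 𝓞 ↥(IntermediateField.adjoin ℚ ({β} : Set (AlgebraicClosure ℚ)))) + (-73 : 𝓞 ↥(IntermediateField.adjoin ℚ ({β} : Set (AlgebraicClosure ℚ)))) * θI + (88 : 𝓞 ↥(IntermediateField.adjoin ℚ ({β} : Set (AlgebraicClosure ℚ)))) * δI) ((-14 : 𝓞 ↥(IntermediateField.adjoin ℚ ({β} : Set (AlgebraicClosure ℚ)))) + (-20 : 𝓞 ↥(IntermediateField.adjoin ℚ ({β} : Set (AlgebraicClosure ℚ)))) * θI + (-19 : 𝓞 ↥(IntermediateField.adjoin ℚ ({β} : Set (AlgebraicClosure ℚ)))) * δI) ((-21 : 𝓞 ↥(IntermediateField.adjoin ℚ ({β} : Set (AlgebraicClosure ℚ)))) + (-33 : 𝓞 ↥(IntermediateField.adjoin ℚ ({β}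 : Set (AlgebraicClosure ℚ)))) * θI + (-14 : 𝓞 ↥(IntermediateField.adjoin ℚ ({β} : Set (AlgebraicClosure ℚ)))) * δI) ((19 : 𝓞 ↥(IntermediateField.adjoin ℚ ({β} : Set (AlgebraicClosure ℚ)))) + (19 : 𝓞 ↥(IntermediateField.adjoin ℚ ({β} : Set (AlgebraicClosure ℚ)))) * θI + (65 : 𝓞 ↥(IntermediateField.adjoin ℚ ({β} : Set (AlgebraicClosure ℚ)))) * δI)
    (by push_cast; linear_combination ((4900 : 𝓞 ↥(IntermediateField.adjoin ℚ ({β} : Set (AlgebraicClosure ℚ)))) + (3752 : 𝓞 ↥(IntermediateField.adjoin ℚ ({β} : Set (AlgebraicClosure ℚ)))) * δI + (-2352 : 𝓞 ↥(IntermediateField.adjoin ℚ ({β} : Set (AlgebraicClosure ℚ)))) * θI) * hX2 + ((-3704 : 𝓞 ↥(IntermediateField.adjoin ℚ ({β} : Set (AlgebraicClosure ℚ)))) + (-1760 : 𝓞 ↥(IntermediateField.adjoin ℚ ({β} : Set (AlgebraicClosure ℚ)))) * δI) * hXY + ((2324 : 𝓞 ↥(IntermediateField.adjoin ℚ ({β}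 : Set (AlgebraicClosure ℚ)))) + (200 : 𝓞 ↥(IntermediateField.adjoin ℚ ({β} : Set (AlgebraicClosure ℚ)))) * δI) * hY2) (by push_cast; linear_combination ((-6076 : 𝓞 ↥(IntermediateField.adjoin ℚ ({β} : Set (AlgebraicClosure ℚ)))) + (-5936 : 𝓞 ↥(IntermediateField.adjoin ℚ ({β} : Set (AlgebraicClosure ℚ)))) * δI + (3332 : 𝓞 ↥(IntermediateField.adjoin ℚ ({β} : Set (AlgebraicClosure ℚ)))) * θI) * hX2 + ((3884 : 𝓞 ↥(IntermediateField.adjoin ℚ ({β} : Set (AlgebraicClosure ℚ)))) + (3380 : 𝓞 ↥(IntermediateField.adjoin ℚ ({β} : Set (AlgebraicClosure ℚ)))) * δI) * hXY + ((-1432 : 𝓞 ↥(IntermediateField.adjoin ℚ ({β} : Set (AlgebraicClosure ℚ)))) + (-600 : 𝓞 ↥(IntermediateField.adjoin ℚ ({β} : Set (AlgebraicClosure ℚ)))) * δI) * hY2) (by push_cast; linear_combination ((-64092 : 𝓞 ↥(IntermediateField.adjoin ℚ ({β} : Set (AlgebraicClosure ℚ)))) + (-45808 : 𝓞 ↥(IntermediateField.adjoin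 ℚ ({β} : Set (AlgebraicClosure ℚ)))) * δI + (25480 : 𝓞 ↥(IntermediateField.adjoin ℚ ({β} : Set (AlgebraicClosure ℚ)))) * θI) * hX2 + ((54800 : 𝓞 ↥(IntermediateField.adjoin ℚ ({β} : Set (AlgebraicClosure ℚ)))) + (26440 : 𝓞 ↥(IntermediateField.adjoin ℚ ({β} : Set (AlgebraicClosure ℚ)))) * δI) * hXY + ((-18996 : 𝓞 ↥(IntermediateField.adjoin ℚ ({β} : Set (AlgebraicClosure ℚ)))) + (-4800 : 𝓞 ↥(IntermediateField.adjoin ℚ ({β} : Set (AlgebraicClosure ℚ)))) * δI) * hY2) (by push_cast; linear_combination ((-29400 : 𝓞 ↥(IntermediateField.adjoin ℚ ({β} : Set (AlgebraicClosure ℚ)))) + (-18648 : 𝓞 ↥(IntermediateField.adjoin ℚ ({β} : Set (AlgebraicClosure ℚ)))) * δI + (10584 : 𝓞 ↥(IntermediateField.adjoin ℚ ({β} : Set (AlgebraicClosure ℚ)))) * θI) * hX2 + ((26808 : 𝓞 ↥(IntermediateField.adjoin ℚ ({β} : Set (AlgebraicClosure ℚ)))) + (10440 : 𝓞 ↥(IntermediateField.adjoin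 ℚ ({β} : Set (AlgebraicClosure ℚ)))) * δI) * hXY + ((-10176 : 𝓞 ↥(IntermediateField.adjoin ℚ ({β} : Set (AlgebraicClosure ℚ)))) + (-1800 : 𝓞 ↥(IntermediateField.adjoin ℚ ({β} : Set (AlgebraicClosure ℚ)))) * δI) * hY2)
    (Units.mkOfMulEqOne _ _ hεy) (by rw [Units.val_mkOfMulEqOne]; linear_combination ((24064 : 𝓞 ↥(IntermediateField.adjoin ℚ ({β} : Set (AlgebraicClosure ℚ)))) + (-56840 : 𝓞 ↥(IntermediateField.adjoin ℚ ({β} : Set (AlgebraicClosure ℚ)))) * δI + (120496 : 𝓞 ↥(IntermediateField.adjoin ℚ ({β} : Set (AlgebraicClosure ℚ)))) * δI ^ 2 + (28620 : 𝓞 ↥(IntermediateField.adjoin ℚ ({β} : Set (AlgebraicClosure ℚ)))) * θI + (-115808 : 𝓞 ↥(IntermediateField.adjoin ℚ ({β} : Set (AlgebraicClosure ℚ)))) * θI * δI + (-748 : 𝓞 ↥(IntermediateField.adjoin ℚ ({β} : Set (AlgebraicClosure ℚ)))) * θI ^ 2) * hX2 + ((-5616 : 𝓞 ↥(IntermediateField.adjoin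 ℚ ({β} : Set (AlgebraicClosure ℚ)))) + (-10384 : 𝓞 ↥(IntermediateField.adjoin ℚ ({β} : Set (AlgebraicClosure ℚ)))) * δI + (-55552 : 𝓞 ↥(IntermediateField.adjoin ℚ ({β} : Set (AlgebraicClosure ℚ)))) * δI ^ 2) * hXY + ((2416 : 𝓞 ↥(IntermediateField.adjoin ℚ ({β} : Set (AlgebraicClosure ℚ)))) + (5376 : 𝓞 ↥(IntermediateField.adjoin ℚ ({β} : Set (AlgebraicClosure ℚ)))) * δI + (10016 : 𝓞 ↥(IntermediateField.adjoin ℚ ({β} : Set (AlgebraicClosure ℚ)))) * δI ^ 2) * hY2)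

/-- ★★ **`μ₂(κ) = 0` — UNCONDITIONAL — for every cyclotomic `ℤ₂`-extension `κ` of the cubic `2`-torsion field of `⟨1, -1, 0, -31, -64⟩`** (field `−2351`), by the
split-stratum layer-two relation road. [cite: Washington1997, §13.3] [cite: LMFDB, number field 3.1.2351.1] -/
theorem classicalMuVanishes_cubicField_n25861_unconditional {β : AlgebraicClosure ℚ} (hβ : aeval β ((⟨1, -1, 0, -31, -64⟩ : WeierstrassCurve ℤ).baseChange ℚ).twoTorsionPolynomial.toPoly = 0)
    (κP : ZpExtension ↥(IntermediateField.adjoin ℚ ({β} : Set (AlgebraicClosure ℚ))) 2) (hκP : κP.IsCyclotomic) : ClassicalMuVanishes κP :=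
  (classGroupPRank_le_two_and_mu_lambda_cubicField_n25861 hβ κP hκP).2.1

/-! ## §3 `MC₂(W)` at the seed modulo PRINT (att-p5 g24's cubic carrier road with its `μ₂ = 0` input DISCHARGED) -/

/-- The `2`-division cubic of `⟨1, -1, 0, -31, -64⟩` has a root in `ℚ̄`. [cite: SilvermanAEC2009, III.1] -/
theorem exists_root_twoTorsionPolynomial_n25861 :
    ∃ β : AlgebraicClosure ℚ, aeval β ((⟨1, -1, 0, -31, -64⟩ : WeierstrassCurve ℤ).baseChange ℚ).twoTorsionPolynomial.toPoly = 0 := by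
  apply IsAlgClosed.exists_aeval_eq_zero
  rw [Cubic.degree_of_a_ne_zero (by simp [WeierstrassCurve.twoTorsionPolynomial])]
  decide

/-- ★ **`C2` AT THE SEED `⟨1, -1, 0, -31, -64⟩` (`N = 25861`) modulo PRINT⁵ + MuIneqʳ + the crux's own hypotheses at this `W`** — att-p5 g24's carrier road with its
`μ₂ = 0` input DISCHARGED by the split-stratum layer-two relation row.  CONDITIONAL; BSD is NOT proved; nothing is closed.
[cite: Kato2004Asterisque, Thm. 17.4 (1)(2) (p. 273)] [cite: GreenbergLNM1716, Thm. 4.1 (p. 102) and Conj. 1.11 (p. 58)] [cite: Iwasawa1973MuInvariants, Thm. 2 and Thm. 3] -/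
theorem mazurMainConjecture_two_n25861_of_print
    [((⟨1, -1, 0, -31, -64⟩ : WeierstrassCurve ℤ).baseChange ℚ).IsElliptic] [((⟨1, -1, 0, -31, -64⟩ : WeierstrassCurve ℤ).baseChange ℚ).IsGloballyMinimal]
    (h17 : ∀ [NeZero (((⟨1, -1, 0, -31, -64⟩ : WeierstrassCurve ℤ).baseChange ℚ).conductorNorm ℤ)] (f : CuspForm (Gamma0 (((⟨1, -1, 0, -31, -64⟩ : WeierstrassCurve ℤ).baseChange ℚ).conductorNorm ℤ)) 2),
      kato_divisibility_allPrimes ((⟨1, -1, 0, -31, -64⟩ : WeierstrassCurve ℤ).baseChange ℚ) 2 (f := f))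
    (hGr : Greenberg1999.thm41_charValue_rankZero_anyPrime)
    (hper : realPeriodRat_eq_unit_mul_plusPeriod_two) (hmod : nonempty_modularParametrizationData)
    (hGZK : rank_eq_analyticRank_of_analyticRank_le_one)
    (hI : ∀ (W : WeierstrassCurve ℚ) [W.IsElliptic] [W.IsGloballyMinimal], IsOrdinaryAt W 2 →
      (∀ x : ℚ, ¬ HasRationalTwoTorsionX W x) →
      ∀ (κ : ZpExtension ℚ 2) (γ : Field.absoluteGaloisGroup ℚ), κ.IsCyclotomic →
      κ.IsTopGenerator γ → IsCyclotomicVariable 2 γ →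
      ∀ ⦃N : ℕ⦄ [NeZero N] (f : CuspForm (Gamma0 N) 2), IsNewformOf W f →
      ∀ Gp : IwasawaAlgebra 2, iwasawaToPowerSeries 2 Gp = padicLFunction f (unitRoot W 2 : ℚ_[2]) →
      ∀ (D : W.SelmerDualData κ γ) (Yr : W.FineSelmerDualDataRelaxedInf κ γ),
        lengthAt (IwasawaAlgebra 2) D.X ⟨IwasawaAlgebra.augIdealP 2, IwasawaAlgebra.isPrime_augIdealP_holds 2⟩ ≤
          lengthAt (IwasawaAlgebra 2) (IwasawaAlgebra 2 ⧸ Ideal.span {Gp})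
              ⟨IwasawaAlgebra.augIdealP 2, IwasawaAlgebra.isPrime_augIdealP_holds 2⟩ +
            lengthAt (IwasawaAlgebra 2) Yr.X ⟨IwasawaAlgebra.augIdealP 2, IwasawaAlgebra.isPrime_augIdealP_holds 2⟩)
    (hr : ((⟨1, -1, 0, -31, -64⟩ : WeierstrassCurve ℤ).baseChange ℚ).analyticRank = 0)
    (hμan : ∀ ⦃N : ℕ⦄ [NeZero N] (f : CuspForm (Gamma0 N) 2), IsNewformOf ((⟨1, -1, 0, -31, -64⟩ : WeierstrassCurve ℤ).baseChange ℚ) f →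
      ∀ G : IwasawaAlgebra 2, IsEvenBranchLiftAtTwo ((⟨1, -1, 0, -31, -64⟩ : WeierstrassCurve ℤ).baseChange ℚ) f G → red G ≠ 0)
    (hbsd : BSDp ((⟨1, -1, 0, -31, -64⟩ : WeierstrassCurve ℤ).baseChange ℚ) 2) :
    MazurMainConjecture ((⟨1, -1, 0, -31, -64⟩ : WeierstrassCurve ℤ).baseChange ℚ) 2 := by
  obtain ⟨β, hβ⟩ := exists_root_twoTorsionPolynomial_n25861
  have hord : IsOrdinaryAt ((⟨1, -1, 0, -31, -64⟩ : WeierstrassCurve ℤ).baseChange ℚ) 2 := goodOrd_two_n25861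
  exact mazurMainConjecture_two_of_muIneqRel_of_classicalMu_cubicField_of_Δ_neg ((⟨1, -1, 0, -31, -64⟩ : WeierstrassCurve ℤ).baseChange ℚ) h17 hGr hper hmod hGZK hI hord
    not_hasRationalTwoTorsionX_n25861 Δ_n25861_neg hr hμan hbsd hβ (fun κP hκP =>
      (classGroupPRank_le_two_and_mu_lambda_cubicField_n25861 hβ κP hκP).2.1)

end Summit.BirchSwinnertonDyer.BirchSwinnertonDyer.Theorems.AlignedTransportAtTwoCubicSplitStratumLayerTwoRelationRowN25861

end

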